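import Literature.AlgebraicGeometry.Motives.AbelianVarietyFiniteOfFibreTranslate
import Literature.AlgebraicGeometry.Motives.AbelianVarietyTranslationLemma
import Literature.AlgebraicGeometry.Motives.AbelianVarietyKThetaOfTranslationSupport
import HarnessLib

/-!
# The finiteness half of Mumford §6 Application 1, unconditionally: a proper morphism on an abelian variety whose closed fibres
# sit in translates of `A ∖ Supp D` is finite when `K(D)` is finite (irreducible support, multiplicity one)

Layer `Literature/AlgebraicGeometry/Motives`, namespace `Literature.AlgebraicGeometry.Motives.AbelianVariety`.  KERNEL ONLY: theorems;
no definition, no named fact, no instance, no `sorry`.  JUNCTION of ★ `Motives/AbelianVarietyFiniteOfFibreTranslate` (A-p07 (g14), letter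
(F) of the cell `hodgecm-mathlib` road G5 (V7-c-ii), conditional on the translation lemma) with ★ `Motives/AbelianVarietyTranslationLemma`
(A-p06 (g16), letter (H): Mumford's translation lemma `image_translation_support_eq_of_subset_preimage`) and ★
`Motives/AbelianVarietyKThetaOfTranslationSupport` (A-p16 (g15), letter (T): the transfer `mem_KTheta_of_image_translation_support_eq`):
the hypotheses `hH`, `hT` are DISCHARGED.

* `isFinite_of_preimage_subset_translate` — letter (F) VERBATIM (binders `(hD) (hirr) (hstab) (φ) (hcov)`).
* `isFinite_of_preimage_subset_translate_of_finite_KTheta` / `_of_KTheta_eq_bot` — with the stabiliser bounded by `K(D)(k)` for a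
  divisor of multiplicity one (`hone : ∀ E m, E.IsEffective → 0 < m → D.SameDivisor (m • E) → m = 1`), the shape the G5 socket `stub_V7c` consumes
  through A-p08 (g13)'s `isAmple_of_isEffective_of_forall_isFinite`.

COUNT-NEUTRAL until the VI-7 closer.  HC_CM is proved only modulo the 7 printed citations until rung 0 closes.

## References
* [MumfordAV1970] D. Mumford, *Abelian Varieties* (1970), §6 Application 1 and its proof (pp. 60–61).
-/

set_option autoImplicit false

noncomputable section

universe u

open CategoryTheory AlgebraicGeometry TopologicalSpace

namespace Literature.AlgebraicGeometry.Motives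

namespace AbelianVariety

variable {k : Type u} [Field k] [IsAlgClosed k] (A : AbelianVariety k) {D : CartierDivisor A.X.left}
  (hD : D.IsEffective) (hirr : IsIrreducible (D.nonvanishing 1)ᶜ)
include hD hirr

/-- **Letter (F), unconditional** ([MumfordAV1970] §6 Application 1, p. 61): for an effective Cartier divisor `D` with irreducible
support on an abelian variety over `k = k̄` whose support has only finitely many translation-stabilisers in `A(k)`, every PROPER
morphism `φ : A → P` to a Jacobson scheme whose closed fibres lie in translates of `A ∖ Supp D` is FINITE (★ (F)
`isFinite_of_preimage_subset_translate_of_translationLemma` with ★ (H) `image_translation_support_eq_of_subset_preimage`).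
[cite: MumfordAV1970, §6 Application 1 and its proof (pp. 60–61)] -/
theorem isFinite_of_preimage_subset_translate
    (hstab : {x : A.Points k | (A.translation x).left.base '' (D.nonvanishing 1)ᶜ = (D.nonvanishing 1)ᶜ}.Finite)
    {P : Scheme.{u}} (φ : A.X.left ⟶ P) [IsProper φ] [JacobsonSpace P]
    (hcov : ∀ p : P, IsClosed ({p} : Set P) →
      ∃ y : A.Points k, φ.base ⁻¹' {p} ⊆ (A.translation y).left.base ⁻¹' (D.nonvanishing 1)) :
    IsFinite φ :=
  A.isFinite_of_preimage_subset_translate_of_translationLemma D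
    (fun _ hZc hZi y hy _ _ hz hz' => A.image_translation_support_eq_of_subset_preimage hD hirr hZc hZi y hy hz hz')
    hstab φ hcov

/-- **With the stabiliser bounded by `K(D)(k)`** (multiplicity one: `t_x(Supp D) = Supp D ⇒ x ∈ K(D)`, ★ (T)
`mem_KTheta_of_image_translation_support_eq`): `K(D)(k)` finite ⇒ `φ` finite. [cite: MumfordAV1970, §6 Application 1 and its proof (pp. 60–61)] -/
theorem isFinite_of_preimage_subset_translate_of_finite_KTheta
    (hone : ∀ (E : CartierDivisor A.X.left) (m : ℕ), E.IsEffective → 0 < m → D.SameDivisor (m • E) → m = 1)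
    (hK : (A.KTheta D : Set (A.Points k)).Finite)
    {P : Scheme.{u}} (φ : A.X.left ⟶ P) [IsProper φ] [JacobsonSpace P]
    (hcov : ∀ p : P, IsClosed ({p} : Set P) →
      ∃ y : A.Points k, φ.base ⁻¹' {p} ⊆ (A.translation y).left.base ⁻¹' (D.nonvanishing 1)) :
    IsFinite φ :=
  A.isFinite_of_preimage_subset_translate_of_finite_KTheta_of_lemmas D
    (fun _ hZc hZi y hy _ _ hz hz' => A.image_translation_support_eq_of_subset_preimage hD hirr hZc hZi y hy hz hz')
    (fun _ hx => A.mem_KTheta_of_image_translation_support_eq hD hirr hone hx) hK φ hcov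

/-- **The `K(D) = ⊥` spelling** (the G5 socket `stub_V7c` carries `hK : A.KTheta D = ⊥`). [cite: MumfordAV1970, §6 Application 1 and its proof (pp. 60–61)] -/
theorem isFinite_of_preimage_subset_translate_of_KTheta_eq_bot
    (hone : ∀ (E : CartierDivisor A.X.left) (m : ℕ), E.IsEffective → 0 < m → D.SameDivisor (m • E) → m = 1)
    (hK : A.KTheta D = ⊥)
    {P : Scheme.{u}} (φ : A.X.left ⟶ P) [IsProper φ] [JacobsonSpace P]
    (hcov : ∀ p : P, IsClosed ({p} : Set P) →
      ∃ y : A.Points k, φ.base ⁻¹' {p} ⊆ (A.translation y).left.base ⁻¹' (D.nonvanishing 1)) :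
    IsFinite φ :=
  A.isFinite_of_preimage_subset_translate_of_KTheta_eq_bot_of_lemmas D
    (fun _ hZc hZi y hy _ _ hz hz' => A.image_translation_support_eq_of_subset_preimage hD hirr hZc hZi y hy hz hz')
    (fun _ hx => A.mem_KTheta_of_image_translation_support_eq hD hirr hone hx) hK φ hcov

end AbelianVariety

end Literature.AlgebraicGeometry.Motives

end
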